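import Literature.MathematicalPhysics.QuantumFieldTheory.Balaban1983to89.B15TreeGauge196

/-!
# `Balaban1983to89.B15TreeGauge196Annulus` — T. Bałaban, *Large field renormalization. I. The basic step of the 𝐑 operation*, Commun. Math. Phys. **122** (1989) 175–202 [Balaban1989LargeFieldI], pp. 195–196 (PART 3/3): the annulus `P₁ ∖ P₂` of lattice sites and the fact the detour is for — every vertex of the contour `Γ_{y,x}`, `x ∈ P₁ ∖ P₂`, lies in `P₁ ∖ P₂` — PROVED

statement-level skeleton of published theorems with citation tags; proofs where landed; nothing here is a claim about the Yang–Mills mass gap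

PDF held: `paper:balaban1989-cmp122-large-field-i` (journal page = PDF page + 174; pp. 179, 195–196 = PDF pp. 5,
21–22; renders `run/shared/lean/pub/pub-balaban/b2b-balaban-ref1/pages/1989-cmp122-large-field-I/…-p021-x2.png`,
`…-p022-x2.png` re-read AS IMAGES).

WHAT IS REPRODUCED (mega-formalization `lit-balaban`, HOME `run/shared/lean/pub/lit-balaban/`, Phase-2 seat p26,
generation 2; serves SKELETON row `B16.Lem@381` via `B16Ineq382TreeGauge`).  P. 195: *"P₁ = [a₁,b₁] × ⋯ × [a_d,b_d]
⊃ P₂ = [a′₁,b′₁] × ⋯ × [a′_d,b′_d], hence [a′_μ,b′_μ] ⊂ [a_μ,b_μ]. We have to fix a gauge in P₁∖P₂, more precisely in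
the intersection with the corresponding lattice"*; p. 196: *"The union of all the contours is a tree graph T on
P₁∖P₂"*.  TYPED: `box lo hi` (the sites of a parallelepiped, an order interval of `ℤ^d`), `ann lo hi lo' hi'`
(`P₁ ∖ P₂`), the geometric hypotheses `Geom` (`P₂` strictly inside `P₁` — the regions of the nested sequence are
"separated by one layer of M-cubes", p. 179 — and `a ∈ (a′₁,b′₁)`, i.e. `lo′₁ − 1 ≤ τ ≤ hi′₁` in integer site
coordinates).  PROVED: **`contour_pathIn`** — for `x ∈ P₁ ∖ P₂` every vertex of `Γ_{y,x}` (`B15TreeGauge196.contour`)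
lies in `P₁ ∖ P₂`: the usual contour because its last segment approaches `P₂` from the side `x₁ ≦ a ≦ b′₁`, the
detour because it runs along the faces `x₂ = y₂`, `x₁ = b₁ − 1/2` of `P₁` and comes back from the far side
`x₁ > a ≥ a′₁ − 1`.  This is what makes every plaquette of the surfaces used on p. 382 of [Balaban1989LargeFieldII]
a plaquette "⊂ Ω″^{~2}_{h+1} ∖ Ω″_{h+1}".

HONEST SCOPE.  As PART 2: one annulus, the printed contour family, nothing about measures or about [IV]'s integrals;
the margins `lo < lo′`, `hi′ < hi` (coordinatewise) are explicit hypotheses.  Unit `lit-balaban-p26`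
(literature-prover-lit-balaban-p26-g2-0).
-/

noncomputable section

open scoped BigOperators

namespace Literature.MathematicalPhysics.QuantumFieldTheory.Balaban1983to89.B15TreeGauge196

open B7Prop1Explicit B8Lemma1NonAbelian

variable {d : ℕ}

/-! ## §2 The boxes `P₁ ⊃ P₂` and the annulus `P₁ ∖ P₂` (p. 195) -/

section Boxes

/-- The lattice sites of a rectangular parallelepiped `[a₁,b₁] × ⋯ × [a_d,b_d]` of p. 195, in integer site coordinates
the order interval `[lo, hi] ⊂ ℤ^d`. [cite: Balaban1989LargeFieldI, p.195] -/
def box (lo hi : Site d) : Set (Site d) := {z | lo ≤ z ∧ z ≤ hi}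

/-- The sites of `P₁ ∖ P₂` (p. 195: "We have to fix a gauge in P₁∖P₂, more precisely in the intersection with the
corresponding lattice"). [cite: Balaban1989LargeFieldI, p.195] -/
def ann (lo hi lo' hi' : Site d) : Set (Site d) := {z | z ∈ box lo hi ∧ z ∉ box lo' hi'}

variable {lo hi lo' hi' : Site d}

/-- `mem_box_iff` — coordinatewise. [cite: Balaban1989LargeFieldI, p.195] -/
theorem mem_box_iff {z : Site d} : z ∈ box lo hi ↔ ∀ κ, lo κ ≤ z κ ∧ z κ ≤ hi κ := by
  simp only [box, Set.mem_setOf_eq, Pi.le_def, ← forall_and]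

/-- `mem_ann_iff` — unfolding. [cite: Balaban1989LargeFieldI, p.195] -/
theorem mem_ann_iff {z : Site d} : z ∈ ann lo hi lo' hi' ↔ z ∈ box lo hi ∧ z ∉ box lo' hi' := Iff.rfl

/-- A site with one coordinate below the inner box is outside it. [cite: Balaban1989LargeFieldI, p.195] -/
theorem not_mem_box_of_lt {z : Site d} (κ : Fin d) (h : z κ < lo' κ) : z ∉ box lo' hi' :=
  fun hz => (not_le.mpr h) ((mem_box_iff.mp hz) κ).1

/-- A site with one coordinate above the inner box is outside it. [cite: Balaban1989LargeFieldI, p.195] -/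
theorem not_mem_box_of_gt {z : Site d} (κ : Fin d) (h : hi' κ < z κ) : z ∉ box lo' hi' :=
  fun hz => (not_le.mpr h) ((mem_box_iff.mp hz) κ).2

/-- A site `z` on the coordinate line of `x ∉ P₂` in direction `κ₀` is outside `P₂` as soon as "`z_{κ₀}` in range"
forces "`x_{κ₀}` in range". [cite: Balaban1989LargeFieldI, p.195] -/
theorem not_mem_box_of_line {z x : Site d} (κ₀ : Fin d) (hzx : ∀ κ, κ ≠ κ₀ → z κ = x κ) (hx : x ∉ box lo' hi')
    (h : lo' κ₀ ≤ z κ₀ → z κ₀ ≤ hi' κ₀ → lo' κ₀ ≤ x κ₀ ∧ x κ₀ ≤ hi' κ₀) : z ∉ box lo' hi' := by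
  intro hz
  rw [mem_box_iff] at hz
  refine hx (mem_box_iff.mpr fun κ => ?_)
  by_cases hκ : κ = κ₀
  · subst hκ; exact h (hz κ).1 (hz κ).2
  · rw [← hzx κ hκ]; exact hz κ

end Boxes

/-! ## §5 The contours stay in `P₁ ∖ P₂` -/

section InAnnulus

variable {n : ℕ}

/-- The site `(a, b, x₃, …, x_d)`: first two coordinates prescribed, the others those of `x`. [cite: Balaban1989LargeFieldI, p.196] -/
def pt (a b : ℤ) (x : Site (n + 3)) : Site (n + 3) :=
  fun κ => if κ.val = 0 then a else if κ.val = 1 then b else x κ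

/-- `pt_i0` — bookkeeping. [cite: Balaban1989LargeFieldI, p.196] -/
@[simp] theorem pt_i0 (a b : ℤ) (x : Site (n + 3)) : pt a b x i0 = a := by simp [pt]

/-- `pt_i1` — bookkeeping. [cite: Balaban1989LargeFieldI, p.196] -/
@[simp] theorem pt_i1 (a b : ℤ) (x : Site (n + 3)) : pt a b x i1 = b := by simp [pt]

/-- `pt_high` — bookkeeping. [cite: Balaban1989LargeFieldI, p.196] -/
theorem pt_high (a b : ℤ) (x : Site (n + 3)) {κ : Fin (n + 3)} (h : 2 ≤ κ.val) : pt a b x κ = x κ := by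
  simp only [pt]; rw [if_neg (by omega), if_neg (by omega)]

/-- `pt_add_e0` — moving in direction `1`. [cite: Balaban1989LargeFieldI, p.196] -/
theorem pt_add_e0 (a b j : ℤ) (x : Site (n + 3)) : pt a b x + j • e i0 = pt (a + j) b x := by
  funext κ
  simp only [Pi.add_apply, zsmul_e_apply, pt, Fin.ext_iff, i0_val]
  split_ifs <;> omega

/-- `pt_sub_e0` — moving backwards in direction `1`. [cite: Balaban1989LargeFieldI, p.196] -/
theorem pt_sub_e0 (a b j : ℤ) (x : Site (n + 3)) : pt a b x - j • e i0 = pt (a - j) b x := by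
  rw [sub_eq_add_neg, ← neg_zsmul, pt_add_e0, ← sub_eq_add_neg]

/-- `pt_add_e1` — moving in direction `2`. [cite: Balaban1989LargeFieldI, p.196] -/
theorem pt_add_e1 (a b j : ℤ) (x : Site (n + 3)) : pt a b x + j • e i1 = pt a (b + j) x := by
  funext κ
  simp only [Pi.add_apply, zsmul_e_apply, pt, Fin.ext_iff, i1_val]
  split_ifs <;> omega

/-- `pt_self` — bookkeeping. [cite: Balaban1989LargeFieldI, p.196] -/
theorem pt_self (x : Site (n + 3)) : pt (x i0) (x i1) x = x := by
  funext κ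
  simp only [pt]
  split_ifs with h0 h1
  · exact congrArg x (Fin.ext h0).symm
  · exact congrArg x (Fin.ext h1).symm
  · rfl

/-- `pt` agrees with `x` off the coordinate `1` when the second entry is `x₂`. [cite: Balaban1989LargeFieldI, p.196] -/
theorem pt_eq_off_i0 (a : ℤ) (x : Site (n + 3)) (κ : Fin (n + 3)) (hκ : κ ≠ i0) : pt a (x i1) x κ = x κ := by
  simp only [pt]
  split_ifs with h0 h1
  · exact absurd (Fin.ext h0) hκ
  · exact congrArg x (Fin.ext h1).symm
  · rfl

/-- The end of the high part of a contour from the corner: `y + (high coordinates of x − y) = (y₁, y₂, x₃, …)`. [cite: Balaban1989LargeFieldI, p.196] -/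
theorem add_restrict_highDirs (lo x : Site (n + 3)) :
    lo + restrict (highDirs n) (x - lo) = pt (lo i0) (lo i1) x := by
  funext κ
  by_cases hκ : 2 ≤ κ.val
  · rw [Pi.add_apply, restrict_apply_of_mem (mem_highDirs.mpr hκ), pt_high _ _ _ hκ, Pi.sub_apply]; ring
  · rw [Pi.add_apply, restrict_apply_of_not_mem (fun h => hκ (mem_highDirs.mp h)), add_zero]
    rcases Nat.lt_succ_iff.mp (not_le.mp hκ) |>.eq_or_lt with e1 | e0
    · have : κ = i1 := Fin.ext e1
      subst this; rw [pt_i1]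
    · have : κ = i0 := Fin.ext (by rw [i0_val]; omega)
      subst this; rw [pt_i0]

variable {lo hi lo' hi' : Site (n + 3)}

/-- Membership of `pt a b x` in a box, coordinatewise. [cite: Balaban1989LargeFieldI, p.196] -/
theorem pt_mem_box_iff {a b : ℤ} {x : Site (n + 3)} :
    pt a b x ∈ box lo hi ↔ (lo i0 ≤ a ∧ a ≤ hi i0) ∧ (lo i1 ≤ b ∧ b ≤ hi i1) ∧
      ∀ κ : Fin (n + 3), 2 ≤ κ.val → lo κ ≤ x κ ∧ x κ ≤ hi κ := by
  rw [mem_box_iff]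
  constructor
  · intro h
    refine ⟨by simpa using h i0, by simpa using h i1, fun κ hκ => ?_⟩
    simpa [pt_high a b x hκ] using h κ
  · rintro ⟨h0, h1, h2⟩ κ
    by_cases hκ : 2 ≤ κ.val
    · rw [pt_high a b x hκ]; exact h2 κ hκ
    · rcases Nat.lt_succ_iff.mp (not_le.mp hκ) |>.eq_or_lt with e1 | e0
      · have : κ = i1 := Fin.ext e1
        subst this; simpa using h1
      · have : κ = i0 := Fin.ext (by rw [i0_val]; omega)
        subst this; simpa using h0

/-- **The geometric hypotheses**: `P₂` strictly inside `P₁` (the regions of the nested sequence are separated by layers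
of cubes, B15 p. 179) and the threshold `a ∈ (a′₁, b′₁)` (p. 196), in integer site coordinates `lo′₁ − 1 ≤ τ ≤ hi′₁`.
[cite: Balaban1989LargeFieldI, p.196] -/
structure Geom (lo hi lo' hi' : Site (n + 3)) (τ : ℤ) : Prop where
  lo_lt : ∀ κ, lo κ < lo' κ
  lt_hi : ∀ κ, hi' κ < hi κ
  le_tau : lo' i0 - 1 ≤ τ
  tau_le : τ ≤ hi' i0

variable {τ : ℤ}

/-- The corner `y` is on the near side of the threshold: `y₁ ≦ a`. [cite: Balaban1989LargeFieldI, p.196] -/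
theorem Geom.lo_le_tau (hG : Geom lo hi lo' hi' τ) : lo i0 ≤ τ := by
  have := hG.lo_lt i0; have := hG.le_tau; omega

/-- **The contours stay in `P₁ ∖ P₂`**: every vertex of `Γ_{y,x}`, `x ∈ P₁ ∖ P₂`, belongs to `P₁ ∖ P₂` (the usual
contour because its last segment approaches `P₂` from the side `x₁ ≦ a`, the detour because it runs along the faces
`x₂ = y₂`, `x₁ = b₁ − 1/2` of `P₁` and comes back from the far side). [cite: Balaban1989LargeFieldI, p.196] -/
theorem contour_pathIn (hG : Geom lo hi lo' hi' τ) {x : Site (n + 3)} (hx : x ∈ ann lo hi lo' hi') :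
    PathIn (ann lo hi lo' hi') lo (contour lo hi τ x) := by
  obtain ⟨hxP, hxQ⟩ := hx
  have hxb := mem_box_iff.mp hxP
  have hv : ∀ κ, 0 ≤ (x - lo) κ := fun κ => by simpa using (hxb κ).1
  have hhigh : ∀ κ : Fin (n + 3), 2 ≤ κ.val → lo κ ≤ x κ ∧ x κ ≤ hi κ := fun κ _ => hxb κ
  -- (a) the high part: vertices `z` with `lo ≤ z ≤ (y₁, y₂, x₃, …)`, so `z₁ = y₁ < a′₁`
  have hA : PathIn (ann lo hi lo' hi') lo (tw (highDirs n) (x - lo)) := by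
    refine pathIn_tw _ highDirs_nodup _ (fun κ _ => hv κ) lo fun z hz1 hz2 => ?_
    rw [add_restrict_highDirs] at hz2
    refine ⟨mem_box_iff.mpr fun κ => ⟨hz1 κ, (hz2 κ).trans ?_⟩, not_mem_box_of_lt i0 ?_⟩
    · by_cases hκ : 2 ≤ κ.val
      · rw [pt_high _ _ _ hκ]; exact (hxb κ).2
      · rcases Nat.lt_succ_iff.mp (not_le.mp hκ) |>.eq_or_lt with e1 | e0
        · have : κ = i1 := Fin.ext e1
          subst this; rw [pt_i1]; exact (hxb i1).1.trans (hxb i1).2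
        · have : κ = i0 := Fin.ext (by rw [i0_val]; omega)
          subst this; rw [pt_i0]; exact (hxb i0).1.trans (hxb i0).2
    · exact lt_of_le_of_lt (by simpa using hz2 i0) (hG.lo_lt i0)
  have hp1 : lo + disp (tw (highDirs n) (x - lo)) = pt (lo i0) (lo i1) x := by
    rw [disp_tw highDirs_nodup, add_restrict_highDirs]
  obtain ⟨m1, hm1⟩ := Int.eq_ofNat_of_zero_le (hv i1)
  have hm1' : x i1 - lo i1 = (m1 : ℤ) := by simpa using hm1
  by_cases hxτ : x i0 ≤ τ
  · -- the usual contour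
    obtain ⟨m0, hm0⟩ := Int.eq_ofNat_of_zero_le (hv i0)
    have hm0' : x i0 - lo i0 = (m0 : ℤ) := by simpa using hm0
    rw [contour_of_le hxτ, treeWord_eq, List.append_assoc, pathIn_append]
    refine ⟨hA, ?_⟩
    rw [hp1, pathIn_append, disp_seg, pt_add_e1, hm1, hm0]
    refine ⟨?_, ?_⟩
    · -- (b) the `2`-segment on the line `z₁ = y₁`
      rw [pathIn_seg_natCast]
      intro j hj
      rw [pt_add_e1]
      refine ⟨pt_mem_box_iff.mpr ⟨⟨le_rfl, (hxb i0).1.trans (hxb i0).2⟩, ⟨by omega, ?_⟩, hhigh⟩,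
        not_mem_box_of_lt i0 (by simpa using hG.lo_lt i0)⟩
      have := (hxb i1).2; omega
    · -- (c) the last `1`-segment, approaching `P₂` from the side `x₁ ≦ a ≦ b′₁`
      rw [pathIn_seg_natCast]
      intro j hj
      rw [show lo i1 + (m1 : ℤ) = x i1 by omega, pt_add_e0]
      refine ⟨pt_mem_box_iff.mpr ⟨⟨by omega, ?_⟩, hxb i1, hhigh⟩,
        not_mem_box_of_line i0 (fun κ hκ => pt_eq_off_i0 _ x κ hκ) hxQ fun h1 _ => ⟨?_, ?_⟩⟩
      · have := (hxb i0).2; omega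
      · simp only [pt_i0] at h1; omega
      · exact hxτ.trans hG.tau_le
  · -- the detour
    have hx0 : lo' i0 ≤ x i0 := by have := hG.le_tau; omega
    obtain ⟨N, hN⟩ := Int.eq_ofNat_of_zero_le (show 0 ≤ hi i0 - lo i0 from by linarith [(hxb i0).1, (hxb i0).2])
    obtain ⟨m, hm⟩ := Int.eq_ofNat_of_zero_le (show 0 ≤ hi i0 - x i0 from by linarith [(hxb i0).2])
    rw [contour_of_not_le hxτ, pathIn_append]
    refine ⟨hA, ?_⟩
    rw [hp1, detourTail, pathIn_append, pathIn_append, disp_append, disp_seg, disp_seg, ← add_assoc,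
      pt_add_e0, pt_add_e1, hN, hm1', show x i0 - hi i0 = -(m : ℤ) by omega]
    refine ⟨⟨?_, ?_⟩, ?_⟩
    · -- (b') along the face `z₂ = y₂ < a′₂` to the far face
      rw [pathIn_seg_natCast]
      intro j hj
      rw [pt_add_e0]
      refine ⟨pt_mem_box_iff.mpr ⟨⟨by omega, ?_⟩, ⟨le_rfl, (hxb i1).1.trans (hxb i1).2⟩, hhigh⟩,
        not_mem_box_of_lt i1 (by simpa using hG.lo_lt i1)⟩
      omega
    · -- (c') on the far face `z₁ = b₁ − 1/2 > b′₁`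
      rw [pathIn_seg_natCast]
      intro j hj
      rw [pt_add_e1]
      refine ⟨pt_mem_box_iff.mpr ⟨⟨by omega, by omega⟩, ⟨by omega, ?_⟩, hhigh⟩,
        not_mem_box_of_gt i0 (by simp; have := hG.lt_hi i0; omega)⟩
      have := (hxb i1).2; omega
    · -- (d') back in direction `1` from the far face down to `x₁ > a ≥ a′₁ − 1`
      rw [pathIn_seg_neg]
      intro j hj
      rw [show lo i0 + (N : ℤ) = hi i0 by omega, show lo i1 + (m1 : ℤ) = x i1 by omega, pt_sub_e0]
      refine ⟨pt_mem_box_iff.mpr ⟨⟨?_, by omega⟩, hxb i1, hhigh⟩,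
        not_mem_box_of_line i0 (fun κ hκ => pt_eq_off_i0 _ x κ hκ) hxQ fun _ h2 => ⟨hx0, ?_⟩⟩
      · have := (hxb i0).1; omega
      · simp only [pt_i0] at h2; omega

end InAnnulus

end Literature.MathematicalPhysics.QuantumFieldTheory.Balaban1983to89.B15TreeGauge196
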